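import Mathlib
import HarnessLib

/-!
# Schur polynomials in `n` variables: bialternants, Jacobi–Trudi, the dual Pieri rule, Shintani's
uniqueness theorem and Cauchy's identity

Topic `RingTheory/SymmetricFunctions`; namespace `Literature.SymmPoly`. Everything in this file is
**proved** (Mathlib only); it is the algebraic kernel of the *unramified computation* of the
Rankin–Selberg integral for `GL_n × GL_n` (Jacquet–Shalika, *On Euler products and the
classification of automorphic representations I*, Amer. J. Math. **103** (1981), §2; Cogdell,
*Lectures on `L`-functions, converse theorems, and functoriality for `GL_n`*, Thm. 3.3), which
rests on two facts about Schur polynomials `s_λ(x_1, …, x_n)`: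

* **Shintani's explicit formula** for the class-one Whittaker function `W` of `GL_n` over a
  `p`-adic field, `W(ϖ^λ) = δ^{1/2}(ϖ^λ) s_λ(α) W(1)` for dominant `λ` and `0` otherwise
  (Shintani 1976), whose proof is: the Hecke eigenvalue equations for the operators
  `T_r = [K diag(ϖ 1_r, 1_{n-r}) K]` are the **dual Pieri recursion**
  `e_r(α) w(λ) = ∑_{ε ∈ {0,1}ⁿ, |ε| = r} w(λ + ε)` for the normalised values `w`, and "the solution
  of the difference equations is unique and given by `s_λ(α) w(0)`" — here
  `eq_schur_smul_of_pieri`, for an arbitrary module-valued `w` and arbitrary `α ∈ Rⁿ`;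
* **Cauchy's identity** `∑_λ s_λ(x) s_λ(y) T^{|λ|} = ∏_{i,j} (1 - x_i y_j T)⁻¹` (Macdonald, Ch. I
  (4.3)), which turns `∑_λ W(ϖ^λ) W'(ϖ^λ) δ⁻¹(ϖ^λ) q^{-|λ|s}` into
  `det(1 - q^{-s} A ⊗ A')⁻¹ W(1) W'(1)` — here `cauchySeries_mul_cauchyProd`, in `R⟦T⟧` for any
  commutative ring `R`, and its corollary `mk_sum_mul_mul_cauchyProd` for a *pair* of solutions of
  dual Pieri recursions (no Whittaker functions, measures or `p`-adic groups appear in this file).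

Mathlib has the elementary, complete homogeneous, power-sum and monomial symmetric polynomials
(`MvPolynomial.esymm/hsymm/psum/msymm`, the fundamental theorem, Newton's identities) but no Schur
polynomials, Jacobi–Trudi, Pieri or Cauchy identity (checked:
`lean search 'schur|Schur|bialternant|JacobiTrudi|Cauchy.?identity'`: no relevant hits).

## Definitions (all "evaluated": functions of a point `x : Fin n → R`, `R` a commutative ring)

* `alternant x μ = det (x_i^{μ_j})` (`a_μ`, Macdonald Ch. I §3), `rho n = (n-1, …, 1, 0)`;
* `esymm x r = e_r(x)` (`= Multiset.esymm`, `esymm_eq_multiset_esymm`); `geom c = ∑ c^m T^m`,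
  `hGen x = ∏_i (1 - x_i T)⁻¹`, `hsymm x k = h_k(x)` (its `T^k`-coefficient;
  `hsymm_eq_sum_piAntidiag` is the monomial expansion), `hsymmZ` (zero for negative index);
* `schur x λ = det (h_{λ_i - i + j}(x))` — the **Jacobi–Trudi determinant taken as the
  definition** (Macdonald (3.4)), so that no division is needed; the bialternant formula
  `a_{λ+ρ} = s_λ a_ρ` of Macdonald's definition (3.1) is then the theorem `alternant_add_rho`,
  valid in every commutative ring (also for repeated `x_i`, the case of interest for Satake
  parameters);
* `addOn S λ = λ + 1_S`; `antitoneWeights n N` (partitions of `N` of length `≤ n` as antitone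
  `λ : Fin n → ℕ`); `cauchyProd x y = ∏_{i,j}(1 - x_i y_j T)`,
  `cauchySeries x y = ∑_λ s_λ(x) s_λ(y) T^{|λ|}`; auxiliary `eGen`, `hMatrix`, `eMatrix`,
  `altSeries`, `suppCard`, `pieriMeasure`.

## Main statements (all proved)

* `hMatrix_mul_eMatrix`, `alternant_eq_det_hMatrix_mul`: Macdonald's proof of (3.4) — the matrix
  factorisation `(h_{μ_i - n + 1 + j}) · ((-1)^{n-1-j} e_{n-1-j}(x^{(k)})) = (x_k^{μ_i})`, from
  `H(t) E^{(k)}(-t) = (1 - x_k t)⁻¹`, giving `a_μ = det(H_μ) a_ρ` for all `μ ∈ ℕⁿ`;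
* `alternant_add_rho`: `a_{λ+ρ} = s_λ a_ρ` (Jacobi–Trudi ⟺ bialternant formula);
* `esymm_mul_alternant`, `esymm_mul_schur`: the dual Pieri rule `e_r s_λ = ∑_{#S=r} s_{λ+1_S}`
  (Macdonald Ch. I §5), via the generic point `ℤ[X]` where `a_ρ ≠ 0` (`alternant_rho_ne_zero`,
  from Mathlib's `Matrix.det_vandermonde_ne_zero_iff`); `schur_addOn_eq_zero`;
* `eq_schur_smul_of_pieri`: **uniqueness** for the dual Pieri recursion (Shintani);
* `det_prod_one_sub_mul`: the **Cauchy determinant** cleared of denominators,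
  `det (∏_{k≠j}(1 - x_i y_k)) = a_ρ(x) a_ρ(y)`, by a second use of the Jacobi–Trudi matrix `M`;
* `altSeries_mul_cauchyProd`, `sum_piAntidiag_eq_sum_antitoneWeights` (sorting
  `m = (λ+ρ)∘τ`), `altSeries_eq_X_pow_mul`, and **Cauchy's identity**
  `cauchySeries_mul_cauchyProd : (∑_λ s_λ(x) s_λ(y) T^{|λ|}) · ∏_{i,j}(1 - x_i y_j T) = 1`;
* `mk_sum_mul_mul_cauchyProd`: for `w, w'` solving the dual Pieri recursions for `x`, `y`:
  `(∑_m w(m) w'(m) T^{|m|}) · ∏_{i,j}(1 - x_i y_j T) = w(0) w'(0)`.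

## References

* I. G. Macdonald, *Symmetric Functions and Hall Polynomials*, 2nd ed., Oxford Univ. Press
  (1995), Ch. I: §2 (`e_r`, `h_r`, `H(t)E(-t) = 1`), §3 ((3.1) `s_λ = a_{λ+δ}/a_δ`, (3.4)
  Jacobi–Trudi and its proof), §4 ((4.3) Cauchy's identity), §5 (Pieri's formula).
* T. Shintani, *On an explicit formula for class-1 "Whittaker functions" on `GL_n` over `P`-adic
  fields*, Proc. Japan Acad. **52** (1976), 180–182 (p. 182: uniqueness of the solution of the
  difference equations).
* M. Miyauchi, *Whittaker functions associated to newforms for `GL(n)` over `p`-adic fields*,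
  J. Math. Soc. Japan **66** (2014), 17–24 = arXiv:1201.3507, §4 (the difference equations
  `q^{…} λ_i w̃(f) = ∑_{ε ∈ I_i} w̃(f + ε)`, `w̃ = 0` off the dominant cone, and their unique
  solution `s_f · W(1)`, "as in [Shintani] p. 182").
* H. Jacquet, J. A. Shalika, Amer. J. Math. **103** (1981), §2 (the unramified computation).
-/


noncomputable section

open Matrix Finset PowerSeries Equiv

namespace Literature.RingTheory.SymmetricFunctions.SymmPoly

variable {R : Type*} [CommRing R] {n : ℕ}

/-! ### Alternants -/

/-- The **alternant** `a_μ(x) = det (x_i^{μ_j})_{i,j} = ∑_{σ ∈ 𝔖ₙ} sign(σ) ∏_i x_{σ(i)}^{μ_i}` of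
an exponent vector `μ ∈ ℕⁿ` at `x ∈ Rⁿ` (Macdonald 1995, Ch. I §3: the polynomial `a_α`
obtained by antisymmetrizing `x^α`, "which can be written as a determinant").
[cite: Macdonald1995, Ch. I §3 (3.1)] -/
def alternant (x : Fin n → R) (μ : Fin n → ℕ) : R :=
  (Matrix.of fun i j : Fin n => x i ^ μ j).det

/-- Leibniz expansion `a_μ(x) = ∑_σ sign(σ) ∏_i x_{σ(i)}^{μ_i}`. [folklore] -/
theorem alternant_eq_sum (x : Fin n → R) (μ : Fin n → ℕ) :
    alternant x μ = ∑ σ : Perm (Fin n), ((Equiv.Perm.sign σ : ℤ) : R) * ∏ i, x (σ i) ^ μ i := by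
  rw [alternant, Matrix.det_apply']
  rfl

/-- The staircase `ρ = (n - 1, n - 2, …, 1, 0)` (Macdonald's `δ`).
[cite: Macdonald1995, Ch. I §3 (3.1)] -/
def rho (n : ℕ) : Fin n → ℕ := fun i => (Fin.rev i : ℕ)

/-- `ρ_i = n - (i + 1)`. [folklore] -/
theorem rho_apply (i : Fin n) : rho n i = n - (i + 1) := by
  simp [rho, Fin.val_rev]

/-- `ρ_i = n - 1 - i` as an integer. [folklore] -/
theorem rho_int (i : Fin n) : ((rho n i : ℕ) : ℤ) = n - 1 - i := by
  have hi := i.is_lt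
  rw [rho_apply, Nat.cast_sub (by omega)]
  push_cast
  ring

/-- An alternant with two equal exponents vanishes (two equal columns). [folklore] -/
theorem alternant_eq_zero_of_apply_eq (x : Fin n → R) {μ : Fin n → ℕ} {i j : Fin n} (hij : i ≠ j)
    (h : μ i = μ j) : alternant x μ = 0 :=
  Matrix.det_zero_of_column_eq hij fun k => by simp [h]

/-- Permuting the exponents multiplies the alternant by the sign: `a_{μ ∘ σ} = sign(σ) a_μ`.
[folklore] -/
theorem alternant_comp_perm (x : Fin n → R) (μ : Fin n → ℕ) (σ : Perm (Fin n)) :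
    alternant x (μ ∘ σ) = ((Equiv.Perm.sign σ : ℤ) : R) * alternant x μ := by
  have : (Matrix.of fun i j : Fin n => x i ^ (μ ∘ σ) j) =
      (Matrix.of fun i j : Fin n => x i ^ μ j).submatrix id σ := rfl
  rw [alternant, this, Matrix.det_permute']
  rfl

/-- Homogeneity: `a_μ(c x) = c^{|μ|} a_μ(x)`. [folklore] -/
theorem alternant_smul (x : Fin n → R) (μ : Fin n → ℕ) (c : R) :
    alternant (c • x) μ = c ^ (∑ j, μ j) * alternant x μ := by
  have : (Matrix.of fun i j : Fin n => (c • x) i ^ μ j) =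
      Matrix.of fun i j : Fin n =>
        (fun j => c ^ μ j) j * (Matrix.of fun i j : Fin n => x i ^ μ j) i j := by
    ext i j
    simp [mul_pow]
  rw [alternant, this, Matrix.det_mul_row, Finset.prod_pow_eq_pow_sum]
  rfl

/-- Alternants commute with ring homomorphisms. [folklore] -/
theorem map_alternant {S : Type*} [CommRing S] (f : R →+* S) (x : Fin n → R) (μ : Fin n → ℕ) :
    f (alternant x μ) = alternant (f ∘ x) μ := by
  rw [alternant, RingHom.map_det]
  congr 1
  ext i j
  simp

/-! ### Elementary symmetric polynomials (evaluated) -/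

/-- The **elementary symmetric polynomial** `e_r(x) = ∑_{#S = r} ∏_{i ∈ S} x_i`, evaluated at `x ∈
Rⁿ` (this is Mathlib's `Multiset.esymm` of the multiset of values, `esymm_eq_multiset_esymm`).
[folklore] -/
def esymm (x : Fin n → R) (r : ℕ) : R := ∑ S ∈ powersetCard r univ, ∏ i ∈ S, x i

/-- `e_r(x)` is Mathlib's `Multiset.esymm` of the multiset `{x_i}`. [folklore] -/
theorem esymm_eq_multiset_esymm (x : Fin n → R) (r : ℕ) :
    esymm x r = ((univ : Finset (Fin n)).val.map x).esymm r :=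
  (Finset.esymm_map_val x univ r).symm

/-- `e_r` is symmetric: `e_r(x ∘ σ) = e_r(x)`. [folklore] -/
theorem esymm_comp_perm (x : Fin n → R) (σ : Perm (Fin n)) (r : ℕ) :
    esymm (x ∘ σ) r = esymm x r := by
  rw [esymm_eq_multiset_esymm, esymm_eq_multiset_esymm, ← Multiset.map_map,
    Multiset.map_univ_val_equiv]

/-- `e_0 = 1`. [folklore] -/
theorem esymm_zero (x : Fin n → R) : esymm x 0 = 1 := by simp [esymm]

/-- `e_r(x_1, …, x_n) = 0` for `r > n`. [folklore] -/
theorem esymm_eq_zero_of_lt (x : Fin n → R) {r : ℕ} (hr : n < r) : esymm x r = 0 := by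
  rw [esymm, Finset.powersetCard_eq_empty.mpr (by simpa using hr), Finset.sum_empty]

/-- `e_r` commutes with ring homomorphisms. [folklore] -/
theorem map_esymm {S : Type*} [CommRing S] (f : R →+* S) (x : Fin n → R) (r : ℕ) :
    f (esymm x r) = esymm (f ∘ x) r := by
  simp [esymm, map_sum, map_prod]

/-! ### Complete homogeneous symmetric polynomials via generating series -/

/-- The geometric series `∑_m c^m T^m = (1 - cT)⁻¹ ∈ R⟦T⟧`. [folklore] -/
def geom (c : R) : R⟦X⟧ := PowerSeries.mk fun m => c ^ m

/-- Coefficients of the geometric series. [folklore] -/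
@[simp] theorem coeff_geom (c : R) (m : ℕ) : coeff m (geom c) = c ^ m := by
  simp [geom]

/-- The geometric series has constant term `1`. [folklore] -/
@[simp] theorem constantCoeff_geom (c : R) : constantCoeff (geom c) = 1 := by
  simp [geom, PowerSeries.constantCoeff_mk]

/-- `(∑_m c^m T^m)(1 - cT) = 1`. [folklore] -/
theorem geom_mul_one_sub (c : R) : geom c * (1 - C c * X) = 1 := by
  have h : geom c * (C c * X) = C c * (X * geom c) := by ring
  rw [mul_sub, mul_one, h]
  ext m
  rcases m with _ | m
  · simp
  · simp [coeff_succ_X_mul, pow_succ, mul_comm]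

/-- Geometric series commute with ring homomorphisms. [folklore] -/
theorem map_geom {S : Type*} [CommRing S] (f : R →+* S) (c : R) :
    PowerSeries.map f (geom c) = geom (f c) := by
  ext m
  simp

/-- The generating series `H_x(T) = ∏_i (1 - x_i T)⁻¹ = ∑_k h_k(x) T^k` of the complete
homogeneous symmetric polynomials (Macdonald 1995, Ch. I §2). [folklore] -/
def hGen (x : Fin n → R) : R⟦X⟧ := ∏ i, geom (x i)

/-- The **complete homogeneous symmetric polynomial** `h_k(x) = ∑_{|m| = k} x^m`, defined as the
coefficient of `T^k` in `H_x(T) = ∏_i (1 - x_i T)⁻¹`; the monomial expansion is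
`hsymm_eq_sum_piAntidiag` (Macdonald 1995, Ch. I §2). [folklore] -/
def hsymm (x : Fin n → R) (k : ℕ) : R := coeff k (hGen x)

/-- `h_0 = 1`. [folklore] -/
theorem hsymm_zero (x : Fin n → R) : hsymm x 0 = 1 := by
  simp [hsymm, hGen, PowerSeries.coeff_zero_eq_constantCoeff, map_prod]

/-- `h_k` commutes with ring homomorphisms. [folklore] -/
theorem map_hsymm {S : Type*} [CommRing S] (f : R →+* S) (x : Fin n → R) (k : ℕ) :
    f (hsymm x k) = hsymm (f ∘ x) k := by
  rw [hsymm, hsymm, ← PowerSeries.coeff_map, hGen, hGen, map_prod]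
  simp [map_geom]

/-- `h_k` for `k ∈ ℤ`, with the convention `h_k = 0` for `k < 0` used in Jacobi–Trudi
determinants. [folklore] -/
def hsymmZ (x : Fin n → R) (k : ℤ) : R := if k < 0 then 0 else hsymm x k.toNat

/-- `h_k = 0` for `k < 0`. [folklore] -/
theorem hsymmZ_of_neg (x : Fin n → R) {k : ℤ} (hk : k < 0) : hsymmZ x k = 0 := by
  simp [hsymmZ, hk]

/-- `h_k` for `k ∈ ℕ ⊆ ℤ`. [folklore] -/
@[simp] theorem hsymmZ_natCast (x : Fin n → R) (k : ℕ) : hsymmZ x k = hsymm x k := by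
  simp [hsymmZ]

/-- `h_0 = 1` (integer index). [folklore] -/
theorem hsymmZ_zero (x : Fin n → R) : hsymmZ x 0 = 1 := by
  simpa [hsymm_zero] using hsymmZ_natCast x 0

/-- `h_k` (`k ∈ ℤ`) commutes with ring homomorphisms. [folklore] -/
theorem map_hsymmZ {S : Type*} [CommRing S] (f : R →+* S) (x : Fin n → R) (k : ℤ) :
    f (hsymmZ x k) = hsymmZ (f ∘ x) k := by
  unfold hsymmZ
  split_ifs <;> simp [map_hsymm]

/-! ### The polynomials `∏_{i ∈ s} (1 - x_i T)` -/

/-- The polynomial `E_s(T) = ∏_{i ∈ s} (1 - x_i T) = ∑_r (-1)^r e_r(x_s) T^r` of a subfamily `s`,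
as a power series. [folklore] -/
def eGen (s : Finset (Fin n)) (x : Fin n → R) : R⟦X⟧ := ∏ i ∈ s, (1 - C (x i) * X)

/-- `[T^r] ∏_{i ∈ s} (1 - x_i T) = (-1)^r e_r(x_s)` where `e_r(x_s) = ∑_{t ⊆ s, #t = r} ∏_{i ∈ t}
x_i` (Macdonald 1995, Ch. I §2, `E(t) = ∏ (1 + x_i t)`). [folklore] -/
theorem coeff_eGen (s : Finset (Fin n)) (x : Fin n → R) (r : ℕ) :
    coeff r (eGen s x) = (-1) ^ r * ∑ t ∈ powersetCard r s, ∏ i ∈ t, x i := by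
  have h1 : eGen s x = ∑ t ∈ s.powerset, C ((-1) ^ t.card * ∏ i ∈ t, x i) * X ^ t.card := by
    unfold eGen
    have : ∀ i ∈ s, (1 - C (x i) * X : R⟦X⟧) = 1 + (C (-x i) * X) := fun i _ => by
      simp [sub_eq_add_neg]
    rw [Finset.prod_congr rfl this, Finset.prod_one_add]
    refine Finset.sum_congr rfl fun t _ => ?_
    rw [Finset.prod_mul_distrib, Finset.prod_const, ← map_prod, Finset.prod_neg]
  have hf : (s.powerset.filter fun t => r = t.card) = powersetCard r s := by
    rw [Finset.powersetCard_eq_filter]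
    exact Finset.filter_congr fun t _ => eq_comm
  rw [h1, map_sum]
  simp_rw [PowerSeries.coeff_C_mul_X_pow]
  rw [← Finset.sum_filter, hf, Finset.mul_sum]
  refine Finset.sum_congr rfl fun t ht => ?_
  rw [(Finset.mem_powersetCard.mp ht).2]

/-- `∏_{i ∈ s} (1 - x_i T)` has degree `≤ #s`. [folklore] -/
theorem coeff_eGen_eq_zero (s : Finset (Fin n)) (x : Fin n → R) {r : ℕ} (hr : s.card < r) :
    coeff r (eGen s x) = 0 := by
  rw [coeff_eGen, Finset.powersetCard_eq_empty.mpr hr]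
  simp

/-- `H_x(T) · ∏_{i ≠ k} (1 - x_i T) = (1 - x_k T)⁻¹` (Macdonald 1995, Ch. I §3, proof of (3.4)).
[folklore] -/
theorem hGen_mul_eGen_erase (x : Fin n → R) (k : Fin n) :
    hGen x * eGen (univ.erase k) x = geom (x k) := by
  unfold hGen eGen
  rw [← Finset.mul_prod_erase univ (fun i => geom (x i)) (mem_univ k), mul_assoc,
    ← Finset.prod_mul_distrib]
  simp [geom_mul_one_sub]

/-- Coefficient form of `H_x(T) ∏_{i ≠ k}(1 - x_i T) = (1 - x_k T)⁻¹`: `∑_{r ≤ N} h_{N-r}(x) ·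
[T^r]∏_{i ≠ k}(1 - x_i T) = x_k^N` (Macdonald 1995, Ch. I §3, proof of (3.4)). [folklore] -/
theorem sum_range_hsymm_mul_coeff_eGen (x : Fin n → R) (k : Fin n) (N : ℕ) :
    ∑ r ∈ range (N + 1), hsymm x (N - r) * coeff r (eGen (univ.erase k) x) = x k ^ N := by
  have h := congrArg (coeff N) (hGen_mul_eGen_erase x k)
  rw [coeff_geom, PowerSeries.coeff_mul] at h
  have h2 : ∑ p ∈ antidiagonal N, coeff p.2 (hGen x) * coeff p.1 (eGen (univ.erase k) x) =
      x k ^ N := by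
    rw [← h]
    exact Finset.Nat.sum_antidiagonal_swap
      (f := fun p => coeff p.1 (hGen x) * coeff p.2 (eGen (univ.erase k) x))
  rw [Finset.Nat.sum_antidiagonal_eq_sum_range_succ
      (fun a b => coeff b (hGen x) * coeff a (eGen (univ.erase k) x))] at h2
  simpa [hsymm] using h2

/-- `∑_{r < n} h_{N-r}(x) · [T^r]∏_{i ≠ k}(1 - x_i T) = x_k^N`, with the `ℤ`-indexed `h`
(vanishing for negative index) and the sum over `r < n` (the polynomial has degree `n - 1`).
[folklore] -/
theorem sum_hsymmZ_mul_coeff_eGen (x : Fin n → R) (k : Fin n) (N : ℕ) :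
    ∑ r ∈ range n, hsymmZ x ((N : ℤ) - r) * coeff r (eGen (univ.erase k) x) = x k ^ N := by
  set F : ℕ → R := fun r => hsymmZ x ((N : ℤ) - r) * coeff r (eGen (univ.erase k) x) with hF
  have hn : 0 < n := Fin.pos k
  have hcard : (univ.erase k).card = n - 1 := by
    rw [Finset.card_erase_of_mem (mem_univ k), Finset.card_univ, Fintype.card_fin]
  have hzero1 : ∀ r, n ≤ r → F r = 0 := fun r hr => by
    simp only [hF]
    rw [coeff_eGen_eq_zero _ _ (by rw [hcard]; omega), mul_zero]
  have hzero2 : ∀ r, N < r → F r = 0 := fun r hr => by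
    simp only [hF]
    rw [hsymmZ_of_neg _ (by omega), zero_mul]
  have key : ∀ M, n ≤ M → N + 1 ≤ M →
      ∑ r ∈ range n, F r = ∑ r ∈ range M, F r ∧ ∑ r ∈ range (N + 1), F r = ∑ r ∈ range M, F r := by
    intro M h1 h2
    constructor
    · exact Finset.sum_subset (Finset.range_subset_range.mpr h1) fun r hr hr' => hzero1 r (by
        simp at hr hr'; omega)
    · exact Finset.sum_subset (Finset.range_subset_range.mpr h2) fun r hr hr' => hzero2 r (by
        simp at hr hr'; omega)
  obtain ⟨e1, e2⟩ := key (max n (N + 1)) (le_max_left _ _) (le_max_right _ _)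
  change ∑ r ∈ range n, F r = _
  rw [e1, ← e2, ← sum_range_hsymm_mul_coeff_eGen x k N]
  refine Finset.sum_congr rfl fun r hr => ?_
  simp only [hF, Finset.mem_range] at hr ⊢
  congr 1
  have : ((N : ℤ) - r) = ((N - r : ℕ) : ℤ) := by omega
  rw [this, hsymmZ_natCast]

/-! ### The Jacobi–Trudi factorisation -/

/-- The matrix `H_μ = (h_{μ_i - ρ_j}(x))_{i,j}` of the Jacobi–Trudi factorisation (Macdonald 1995,
Ch. I §3, proof of (3.4)). [folklore] -/
def hMatrix (x : Fin n → R) (μ : Fin n → ℕ) : Matrix (Fin n) (Fin n) R :=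
  Matrix.of fun i j => hsymmZ x ((μ i : ℤ) - rho n j)

/-- The matrix `M = ([T^{ρ_j}] ∏_{i ≠ k} (1 - x_i T))_{j,k} = ((-1)^{n-1-j}
e_{n-1-j}(x^{(k)}))_{j,k}` of the Jacobi–Trudi factorisation (Macdonald 1995, Ch. I §3, proof
of (3.4)). [folklore] -/
def eMatrix (x : Fin n → R) : Matrix (Fin n) (Fin n) R :=
  Matrix.of fun j k => coeff (rho n j) (eGen (univ.erase k) x)

/-- **Jacobi–Trudi factorisation** `H_μ · M = (x_k^{μ_i})_{i,k}` for every exponent vector `μ ∈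
ℕⁿ` (Macdonald 1995, Ch. I §3, proof of (3.4)). [folklore] -/
theorem hMatrix_mul_eMatrix (x : Fin n → R) (μ : Fin n → ℕ) :
    hMatrix x μ * eMatrix x = Matrix.of fun i k => x k ^ μ i := by
  ext i k
  rw [Matrix.mul_apply, Matrix.of_apply, ← sum_hsymmZ_mul_coeff_eGen x k (μ i),
    ← Fin.sum_univ_eq_sum_range
      (fun r => hsymmZ x ((μ i : ℤ) - r) * coeff r (eGen (univ.erase k) x)),
    ← Equiv.sum_comp Fin.revPerm]
  exact Finset.sum_congr rfl fun j _ => by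
    simp only [hMatrix, eMatrix, Matrix.of_apply, Fin.revPerm_apply, rho, Fin.rev_rev]

/-- `det H_ρ = 1`: `H_ρ = (h_{j-i})` is upper unitriangular. [folklore] -/
theorem det_hMatrix_rho (x : Fin n → R) : (hMatrix x (rho n)).det = 1 := by
  have hentry : ∀ i j : Fin n, hMatrix x (rho n) i j = hsymmZ x ((j : ℤ) - i) := fun i j => by
    simp only [hMatrix, Matrix.of_apply, rho_int]
    ring_nf
  rw [Matrix.det_of_upperTriangular]
  · simp [hentry, hsymmZ_zero]
  · intro i j hij
    rw [hentry]
    exact hsymmZ_of_neg _ (by simp only [id_eq] at hij; omega)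

/-- `a_μ(x) = det (x_k^{μ_i})_{i,k}` (transpose). [folklore] -/
theorem alternant_eq_det_transpose (x : Fin n → R) (μ : Fin n → ℕ) :
    alternant x μ = (Matrix.of fun i k : Fin n => x k ^ μ i).det := by
  rw [alternant, ← Matrix.det_transpose]
  rfl

/-- `det M = a_ρ(x)` (take `μ = ρ` in the factorisation). [folklore] -/
theorem det_eMatrix (x : Fin n → R) : (eMatrix x).det = alternant x (rho n) := by
  rw [alternant_eq_det_transpose, ← hMatrix_mul_eMatrix, Matrix.det_mul, det_hMatrix_rho, one_mul]

/-- `a_μ = det(H_μ) · a_ρ` for every `μ ∈ ℕⁿ`, in any commutative ring (Macdonald 1995, Ch. I §3,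
proof of (3.4)). [folklore] -/
theorem alternant_eq_det_hMatrix_mul (x : Fin n → R) (μ : Fin n → ℕ) :
    alternant x μ = (hMatrix x μ).det * alternant x (rho n) := by
  rw [alternant_eq_det_transpose x μ, ← hMatrix_mul_eMatrix, Matrix.det_mul, det_eMatrix]

/-! ### Schur polynomials (Jacobi–Trudi as the definition) -/

/-- The **Schur polynomial** `s_λ(x_1, …, x_n)` of a weight `λ ∈ ℕⁿ`, *defined* by the
Jacobi–Trudi determinant `s_λ = det (h_{λ_i - i + j})_{1 ≤ i,j ≤ n}` (Macdonald 1995, Ch. I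
(3.4)); it satisfies the bialternant formula `a_{λ+ρ} = s_λ a_ρ` of Macdonald's definition
(3.1) in every commutative ring (`alternant_add_rho`), with no division. Intended for antitone
`λ` (partitions of length `≤ n`); for other `λ` it is the usual signed-or-zero extension.
[cite: Macdonald1995, Ch. I (3.1), (3.4)] -/
def schur (x : Fin n → R) (la : Fin n → ℕ) : R :=
  (Matrix.of fun i j : Fin n => hsymmZ x ((la i : ℤ) - (i : ℕ) + (j : ℕ))).det

/-- `H_{λ+ρ}` is the Jacobi–Trudi matrix `(h_{λ_i - i + j})`. [folklore] -/
theorem hMatrix_add_rho (x : Fin n → R) (la : Fin n → ℕ) :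
    hMatrix x (la + rho n) =
      Matrix.of fun i j : Fin n => hsymmZ x ((la i : ℤ) - (i : ℕ) + (j : ℕ)) := by
  ext i j
  simp only [hMatrix, Matrix.of_apply, Pi.add_apply, Nat.cast_add, rho_int]
  ring_nf

/-- **Bialternant formula / Jacobi–Trudi identity**: `a_{λ+ρ}(x) = s_λ(x) · a_ρ(x)` for every `λ ∈
ℕⁿ` and every `x` in a commutative ring (Macdonald 1995, Ch. I (3.1) with (3.4)).
[cite: Macdonald1995, Ch. I (3.1), (3.4)] -/
theorem alternant_add_rho (x : Fin n → R) (la : Fin n → ℕ) :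
    alternant x (la + rho n) = schur x la * alternant x (rho n) := by
  rw [alternant_eq_det_hMatrix_mul, hMatrix_add_rho]
  rfl

/-- `s_0 = 1`. [folklore] -/
theorem schur_zero (x : Fin n → R) : schur x 0 = 1 := by
  have h := det_hMatrix_rho x
  rwa [show rho n = 0 + rho n from (zero_add _).symm, hMatrix_add_rho] at h

/-- Schur polynomials commute with ring homomorphisms. [folklore] -/
theorem map_schur {S : Type*} [CommRing S] (f : R →+* S) (x : Fin n → R) (la : Fin n → ℕ) :
    f (schur x la) = schur (f ∘ x) la := by
  rw [schur, RingHom.map_det]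
  congr 1
  ext i j
  simp [map_hsymmZ]

/-! ### Dual Pieri rule -/

/-- `λ + 1_S`: add `1` to the coordinates in `S` (a vertical strip when `λ` and `λ + 1_S` are both
antitone). [folklore] -/
def addOn (S : Finset (Fin n)) (μ : Fin n → ℕ) : Fin n → ℕ :=
  fun i => if i ∈ S then μ i + 1 else μ i

/-- `(λ + 1_S)_i = λ_i + [i ∈ S]`. [folklore] -/
theorem addOn_apply (S : Finset (Fin n)) (μ : Fin n → ℕ) (i : Fin n) :
    addOn S μ i = μ i + if i ∈ S then 1 else 0 := by
  unfold addOn; split_ifs <;> simp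

/-- `(λ + ν) + 1_S = (λ + 1_S) + ν`. [folklore] -/
theorem addOn_add (S : Finset (Fin n)) (μ ν : Fin n → ℕ) : addOn S (μ + ν) = addOn S μ + ν := by
  ext i; simp [addOn_apply]; ring

/-- `y^{λ + 1_S} = (∏_{i ∈ S} y_i) · y^λ`. [folklore] -/
theorem prod_pow_addOn (S : Finset (Fin n)) (μ : Fin n → ℕ) (y : Fin n → R) :
    ∏ i, y i ^ addOn S μ i = (∏ i ∈ S, y i) * ∏ i, y i ^ μ i := by
  simp_rw [addOn_apply, pow_add, Finset.prod_mul_distrib, pow_ite, pow_one, pow_zero,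
    Finset.prod_ite_mem, Finset.univ_inter]
  ring

/-- **Dual Pieri rule for alternants**: `e_r(x) a_μ(x) = ∑_{#S = r} a_{μ + 1_S}(x)` for every `μ ∈
ℕⁿ` (expand `e_r(x) = e_r(x ∘ σ)` inside the Leibniz sum). [folklore] -/
theorem esymm_mul_alternant (x : Fin n → R) (r : ℕ) (μ : Fin n → ℕ) :
    esymm x r * alternant x μ = ∑ S ∈ powersetCard r univ, alternant x (addOn S μ) := by
  simp_rw [alternant_eq_sum, Finset.mul_sum]
  rw [Finset.sum_comm]
  refine Finset.sum_congr rfl fun σ _ => ?_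
  rw [mul_left_comm, ← esymm_comp_perm x σ r, esymm, Finset.sum_mul, Finset.mul_sum]
  refine Finset.sum_congr rfl fun S _ => ?_
  rw [prod_pow_addOn S μ (fun i => x (σ i))]
  rfl

/-- `a_ρ(x) = sign(rev) · det V(x)` with Mathlib's Vandermonde matrix `V(x)_{ij} = x_i^j` (the
columns of `a_ρ` are those of `V` in reverse order). [folklore] -/
theorem alternant_rho_eq_sign_mul_det_vandermonde (x : Fin n → R) :
    alternant x (rho n) =
      ((Equiv.Perm.sign (Fin.revPerm : Perm (Fin n)) : ℤ) : R) * (Matrix.vandermonde x).det := by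
  have h1 : (Matrix.of fun i j : Fin n => x i ^ rho n j) =
      (Matrix.vandermonde x).submatrix id Fin.revPerm := by
    ext i j
    simp [Matrix.vandermonde, rho]
  rw [alternant, h1, Matrix.det_permute']

/-- `a_ρ(x) ≠ 0` when the `x_i` are pairwise distinct elements of a domain (Vandermonde).
[folklore] -/
theorem alternant_rho_ne_zero [IsDomain R] {x : Fin n → R} (hx : Function.Injective x) :
    alternant x (rho n) ≠ 0 := by
  rw [alternant_rho_eq_sign_mul_det_vandermonde]
  refine mul_ne_zero ?_ (Matrix.det_vandermonde_ne_zero_iff.mpr hx)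
  rcases Int.units_eq_one_or (Equiv.Perm.sign (Fin.revPerm : Perm (Fin n))) with h | h <;>
    simp [h]

/-- **Dual Pieri rule** (Pieri's formula for `e_r`): `e_r(x) s_λ(x) = ∑_{#S = r} s_{λ + 1_S}(x)`
for every `λ ∈ ℕⁿ`, `r ∈ ℕ` and `x` in a commutative ring; for antitone `λ` the terms with `λ
+ 1_S` not antitone vanish (`schur_addOn_eq_zero`), leaving the sum over vertical `r`-strips
(Macdonald 1995, Ch. I §5, Pieri's formula). Proved at the generic point `ℤ[X_1, …, X_n]` by
cancelling `a_ρ ≠ 0` in `e_r a_{λ+ρ} = ∑_S a_{λ+1_S+ρ}`, then specialised. [folklore] -/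
theorem esymm_mul_schur (x : Fin n → R) (r : ℕ) (la : Fin n → ℕ) :
    esymm x r * schur x la = ∑ S ∈ powersetCard r univ, schur x (addOn S la) := by
  -- generic point
  have key : ∀ (X : Fin n → MvPolynomial (Fin n) ℤ), Function.Injective X →
      esymm X r * schur X la = ∑ S ∈ powersetCard r univ, schur X (addOn S la) := by
    intro X hX
    have h := esymm_mul_alternant X r (la + rho n)
    simp_rw [addOn_add, alternant_add_rho, ← Finset.sum_mul, ← mul_assoc] at h
    exact mul_right_cancel₀ (alternant_rho_ne_zero hX) h
  set f : MvPolynomial (Fin n) ℤ →+* R := MvPolynomial.eval₂Hom (Int.castRingHom R) x with hf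
  have hx : (f ∘ MvPolynomial.X : Fin n → R) = x := funext fun i => by simp [hf]
  have h := congrArg f (key MvPolynomial.X (MvPolynomial.X_injective))
  rw [map_mul, map_sum, map_esymm, map_schur, hx] at h
  rw [h]
  exact Finset.sum_congr rfl fun S _ => by rw [map_schur, hx]

/-- If `λ` is antitone but `λ + 1_S` is not, then `s_{λ + 1_S} = 0`: two consecutive rows of the
Jacobi–Trudi matrix coincide (Macdonald 1995, Ch. I §3, after (3.1): `s_λ = 0` when the `λ_i +
n - i` are not all distinct). [folklore] -/
theorem schur_addOn_eq_zero (x : Fin n → R) {la : Fin n → ℕ} (hla : Antitone la)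
    {S : Finset (Fin n)} (hS : ¬ Antitone (addOn S la)) : schur x (addOn S la) = 0 := by
  -- find i with (addOn S la) i < (addOn S la) (i+1)
  simp only [Antitone, not_forall, not_le, exists_prop] at hS
  obtain ⟨a, b, hab, hlt⟩ := hS
  have hab' : a < b := lt_of_le_of_ne hab (by rintro rfl; exact lt_irrefl _ hlt)
  -- there is a consecutive pair
  obtain ⟨i, hi, hi'⟩ : ∃ i : Fin n, ∃ h : (i : ℕ) + 1 < n,
      addOn S la i < addOn S la ⟨(i : ℕ) + 1, h⟩ := by
    by_contra! hcon
    -- then addOn S la is antitone on the chain from a to b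
    have : ∀ k : ℕ, ∀ hk : (a : ℕ) + k < n, addOn S la ⟨(a : ℕ) + k, hk⟩ ≤ addOn S la a := by
      intro k
      induction k with
      | zero => intro hk; exact le_of_eq (by congr)
      | succ k ih =>
        intro hk
        have hk' : (a : ℕ) + k < n := by omega
        have := hcon ⟨(a : ℕ) + k, hk'⟩ (by simpa [add_assoc] using hk)
        exact le_trans (by simpa [add_assoc] using this) (ih hk')
    have hb : (a : ℕ) + ((b : ℕ) - a) < n := by have := b.is_lt; omega
    have := this ((b : ℕ) - a) hb
    have hbeq : (⟨(a : ℕ) + ((b : ℕ) - a), hb⟩ : Fin n) = b := by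
      ext; simp; omega
    rw [hbeq] at this
    exact absurd hlt (not_lt.mpr this)
  set j : Fin n := ⟨(i : ℕ) + 1, hi⟩ with hj
  have hij : i ≤ j := by rw [Fin.le_def, hj]; simp
  have h1 := hla hij
  have heq : addOn S la j = addOn S la i + 1 := by
    simp only [addOn] at hi' ⊢
    split_ifs at hi' ⊢ with h2 h3 h3 <;> omega
  -- rows i and j of the Jacobi–Trudi matrix coincide
  have hne : i ≠ j := by
    intro h
    have := congrArg Fin.val h
    simp [hj] at this
  have hjv : ((j : ℕ) : ℤ) = (i : ℕ) + 1 := by simp [hj]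
  unfold schur
  refine Matrix.det_zero_of_row_eq hne ?_
  ext k
  simp only [Matrix.of_apply]
  rw [heq]
  push_cast
  rw [hjv]
  ring_nf

/-! ### Shintani's uniqueness theorem for the dual Pieri recursion -/

section Uniqueness

/-- The number of non-zero coordinates of a weight. [folklore] -/
def suppCard (μ : Fin n → ℕ) : ℕ := (univ.filter fun i => μ i ≠ 0).card

/-- A weight has at most `n` non-zero coordinates. [folklore] -/
theorem suppCard_le (μ : Fin n → ℕ) : suppCard μ ≤ n :=
  (Finset.card_filter_le _ _).trans (by simp)

/-- The induction measure `(n + 1)|μ| + (n - #supp μ)` for the uniqueness theorem. [folklore] -/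
def pieriMeasure (μ : Fin n → ℕ) : ℕ := (∑ i, μ i) * (n + 1) + (n - suppCard μ)

/-- `|μ| = |μ - 1_{supp μ}| + #supp μ`. [folklore] -/
theorem sum_eq_sum_sub_one_add_suppCard (μ : Fin n → ℕ) :
    ∑ i, μ i = ∑ i, (μ i - 1) + suppCard μ := by
  rw [suppCard, Finset.card_filter, ← Finset.sum_add_distrib]
  refine Finset.sum_congr rfl fun i _ => ?_
  split_ifs with h <;> omega

/-- `|λ + 1_S| = |λ| + #S`. [folklore] -/
theorem sum_addOn (S : Finset (Fin n)) (μ : Fin n → ℕ) :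
    ∑ i, addOn S μ i = ∑ i, μ i + S.card := by
  simp_rw [addOn_apply, Finset.sum_add_distrib, Finset.sum_boole, Finset.filter_mem_eq_inter,
    Finset.univ_inter, Nat.cast_id]

variable {M : Type*} [AddCommGroup M] [Module R M]

/-- **Uniqueness of solutions of the dual Pieri recursion (Shintani).** Let `w : ℕⁿ → M` vanish at
non-antitone weights and satisfy `e_r(x) • w(λ) = ∑_{#S = r} w(λ + 1_S)` for all antitone `λ`
and `1 ≤ r ≤ n`. Then `w(μ) = s_μ(x) • w(0)` for every antitone `μ`. This is the algebraic
skeleton of Shintani's evaluation of the class-one Whittaker function on `GL_n` over a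
`p`-adic field: the Hecke eigenvalue equations are this recursion with `e_r(x)` the elementary
symmetric functions of the Satake parameters, and "the solution of the above difference
equations is unique and given by `s_f(μ) W(1)`" (Miyauchi 2014, proof of the main theorem,
after Shintani 1976, p. 182). Proof: induction on `(n+1)|μ| + (n - #supp μ)`, applying the
recursion at `(μ - 1_{supp μ}, #supp μ)` and Pieri's formula for `s`.
[cite: Miyauchi2014, proof of Theorem 4 (arXiv numbering)] -/
theorem eq_schur_smul_of_pieri (x : Fin n → R) (w : (Fin n → ℕ) → M)
    (h0 : ∀ ν, ¬ Antitone ν → w ν = 0)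
    (hrec : ∀ la, Antitone la → ∀ r, 1 ≤ r → r ≤ n →
      esymm x r • w la = ∑ S ∈ powersetCard r univ, w (addOn S la))
    {μ : Fin n → ℕ} (hμ : Antitone μ) : w μ = schur x μ • w 0 := by
  suffices H : ∀ N, ∀ μ : Fin n → ℕ, Antitone μ → pieriMeasure μ = N →
      w μ - schur x μ • w 0 = 0 from
    sub_eq_zero.mp (H _ μ hμ rfl)
  intro N
  induction N using Nat.strong_induction_on with
  | _ N ih =>
  intro μ hμ hN
  by_cases hzero : μ = 0
  · subst hzero
    simp [schur_zero]
  -- the support `T` of `μ` and its cardinality `k`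
  set T : Finset (Fin n) := univ.filter fun i => μ i ≠ 0 with hT
  set k : ℕ := T.card with hk
  have hkT : suppCard μ = k := rfl
  have hkpos : 1 ≤ k := by
    rw [Nat.one_le_iff_ne_zero, hk, Ne, Finset.card_eq_zero]
    intro hemp
    apply hzero
    funext i
    have hi : i ∉ T := by rw [hemp]; simp
    simpa [hT] using hi
  have hkn : k ≤ n := hkT ▸ suppCard_le μ
  -- `la = μ - 1_T`
  set la : Fin n → ℕ := fun i => μ i - 1 with hla
  have hla_anti : Antitone la := fun a b hab => Nat.sub_le_sub_right (hμ hab) 1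
  have hμla : addOn T la = μ := by
    funext i
    simp only [addOn, hT, Finset.mem_filter, Finset.mem_univ, true_and, hla]
    split_ifs with h <;> omega
  have e1 : ∑ i, μ i = ∑ i, la i + k := sum_eq_sum_sub_one_add_suppCard μ
  -- the recursion for `d = w - s • w 0` at `(la, k)`
  have hd : esymm x k • (w la - schur x la • w 0) =
      ∑ S ∈ powersetCard k univ, (w (addOn S la) - schur x (addOn S la) • w 0) := by
    rw [smul_sub, hrec la hla_anti k hkpos hkn, ← mul_smul, esymm_mul_schur, Finset.sum_smul,
      Finset.sum_sub_distrib]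
  -- induction hypothesis for `la`
  have hmeasla : pieriMeasure la < N := by
    rw [← hN]
    unfold pieriMeasure
    rw [e1, add_mul, hkT]
    have f2 : n + 1 ≤ k * (n + 1) := Nat.le_mul_of_pos_left _ hkpos
    have f3 := suppCard_le la
    omega
  rw [ih _ hmeasla la hla_anti rfl, smul_zero] at hd
  -- split off the term `S = T`
  have hTmem : T ∈ powersetCard k univ := by simp [Finset.mem_powersetCard, hk]
  rw [← Finset.add_sum_erase _ _ hTmem, hμla] at hd
  -- the remaining terms vanish
  have hrest : ∑ S ∈ (powersetCard k univ).erase T,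
      (w (addOn S la) - schur x (addOn S la) • w 0) = 0 := by
    refine Finset.sum_eq_zero fun S hS => ?_
    obtain ⟨hST, hS⟩ := Finset.mem_erase.mp hS
    have hScard : S.card = k := (Finset.mem_powersetCard.mp hS).2
    by_cases hanti : Antitone (addOn S la)
    · refine ih (pieriMeasure (addOn S la)) ?_ _ hanti rfl
      -- same size, strictly larger support
      obtain ⟨j, hjS, hjT⟩ : ∃ j ∈ S, j ∉ T := by
        by_contra! hsub
        exact hST (Finset.eq_of_subset_of_card_le (fun i hi => hsub i hi) (by rw [hScard, hk]))
      have hμj : μ j = 0 := by simpa [hT] using hjT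
      have hνj : addOn S la j = 1 := by simp [addOn, hjS, hla, hμj]
      have hsupp : insert j T ⊆ univ.filter fun i => addOn S la i ≠ 0 := by
        intro i hi
        rcases Finset.mem_insert.mp hi with rfl | hiT
        · simp [hνj]
        · have hμi : μ i ≠ 0 := by simpa [hT] using hiT
          have hij : i ≤ j := by
            by_contra hji
            exact hμi (Nat.le_zero.mp (hμj ▸ hμ (le_of_not_ge hji)))
          have := hanti hij
          rw [hνj] at this
          simp only [Finset.mem_filter, Finset.mem_univ, true_and]
          omega
      have hcard : k + 1 ≤ suppCard (addOn S la) := by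
        have := Finset.card_le_card hsupp
        rwa [Finset.card_insert_of_notMem hjT, ← hk] at this
      have e2 : ∑ i, addOn S la i = ∑ i, μ i := by rw [sum_addOn, hScard, e1]
      have f3 := suppCard_le (addOn S la)
      rw [← hN]
      unfold pieriMeasure
      rw [e2, hkT]
      omega
    · rw [h0 _ hanti, schur_addOn_eq_zero x hla_anti hanti, zero_smul, sub_zero]
  rw [hrest, add_zero] at hd
  exact hd.symm

end Uniqueness

/-! ### The Cauchy determinant, cleared of denominators -/

/-- `∏_{k ∈ s} (1 - u y_k) = ∑_r u^r · [T^r]∏_{k ∈ s}(1 - y_k T)` (evaluation of the polynomial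
`E_s` at `u`). [folklore] -/
theorem prod_one_sub_mul_eq_sum (s : Finset (Fin n)) (y : Fin n → R) (u : R) :
    ∏ k ∈ s, (1 - u * y k) = ∑ r ∈ range (s.card + 1), u ^ r * coeff r (eGen s y) := by
  have h1 : ∏ k ∈ s, (1 - u * y k) = ∑ t ∈ s.powerset, (-u) ^ t.card * ∏ k ∈ t, y k := by
    have : ∀ k ∈ s, (1 - u * y k) = 1 + (-u * y k) := fun k _ => by ring
    rw [Finset.prod_congr rfl this, Finset.prod_one_add]
    refine Finset.sum_congr rfl fun t _ => ?_
    rw [Finset.prod_mul_distrib, Finset.prod_const]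
  rw [h1, Finset.powerset_card_disjiUnion, Finset.sum_disjiUnion]
  refine Finset.sum_congr rfl fun r _ => ?_
  rw [coeff_eGen, Finset.mul_sum, Finset.mul_sum]
  refine Finset.sum_congr rfl fun t ht => ?_
  rw [(Finset.mem_powersetCard.mp ht).2, neg_pow]
  ring

/-- **Cauchy's determinant, division free**: `det (∏_{k ≠ j} (1 - x_i y_k))_{i,j} = a_ρ(x) ·
a_ρ(y)` in any commutative ring — the classical evaluation `det (1/(1 - x_i y_j)) = a_ρ(x)
a_ρ(y) / ∏_{i,j}(1 - x_i y_j)` cleared of denominators; proved by the factorisation `(∏_{k ≠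
j}(1 - x_i y_k))_{i,j} = (x_i^{ρ_m})_{i,m} · M(y)` with `det M(y) = a_ρ(y)` (`det_eMatrix`).
[folklore] -/
theorem det_prod_one_sub_mul (x y : Fin n → R) :
    (Matrix.of fun i j : Fin n => ∏ k ∈ univ.erase j, (1 - x i * y k)).det =
      alternant x (rho n) * alternant y (rho n) := by
  have hP : (Matrix.of fun i j : Fin n => ∏ k ∈ univ.erase j, (1 - x i * y k)) =
      (Matrix.of fun i m : Fin n => x i ^ rho n m) * eMatrix y := by
    ext i j
    have hn : (univ.erase j).card + 1 = n := by
      rw [Finset.card_erase_of_mem (mem_univ j), Finset.card_univ, Fintype.card_fin]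
      have := Fin.pos j
      omega
    rw [Matrix.mul_apply, Matrix.of_apply, prod_one_sub_mul_eq_sum, hn,
      ← Fin.sum_univ_eq_sum_range (fun r => x i ^ r * coeff r (eGen (univ.erase j) y)),
      ← Equiv.sum_comp Fin.revPerm]
    simp only [eMatrix, Matrix.of_apply, Fin.revPerm_apply, rho]
  rw [hP, Matrix.det_mul, det_eMatrix]
  rfl

/-! ### Cauchy's identity for bialternants -/

/-- The Cauchy product `Π_{x,y}(T) = ∏_{i,j} (1 - x_i y_j T) ∈ R⟦T⟧`. [folklore] -/
def cauchyProd (x y : Fin n → R) : R⟦X⟧ := ∏ i, ∏ j, (1 - C (x i * y j) * X)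

/-- The series `A_{x,y}(T) = ∑_{m ∈ ℕⁿ} a_m(x) y^m T^{|m|} = ∑_σ sign(σ) ∏_i (1 - x_{σ(i)} y_i
T)⁻¹`. [folklore] -/
def altSeries (x y : Fin n → R) : R⟦X⟧ :=
  PowerSeries.mk fun N => ∑ m ∈ piAntidiag univ N, alternant x m * ∏ i, y i ^ m i

/-- Reindex a sum over `Finset.finsuppAntidiag univ N` (finitely supported functions) by
`Finset.piAntidiag univ N` (functions). [folklore] -/
theorem sum_finsuppAntidiag_eq_sum_piAntidiag {A : Type*} [AddCommMonoid A] (N : ℕ)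
    (F : (Fin n → ℕ) → A) :
    ∑ l ∈ finsuppAntidiag (univ : Finset (Fin n)) N, F l = ∑ m ∈ piAntidiag univ N, F m := by
  refine Finset.sum_nbij' (fun l => ⇑l) (fun m => Finsupp.equivFunOnFinite.symm m) ?_ ?_ ?_ ?_ ?_
  · intro l hl
    rw [mem_finsuppAntidiag] at hl
    rw [mem_piAntidiag]
    exact ⟨hl.1, fun i _ => mem_univ i⟩
  · intro m hm
    rw [mem_piAntidiag] at hm
    rw [mem_finsuppAntidiag]
    refine ⟨?_, Finset.subset_univ _⟩
    simpa using hm.1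
  · intro l _
    ext i
    simp
  · intro m _
    simp
  · intro l _
    rfl

/-- `[T^N] ∏_i (1 - c_i T)⁻¹ = ∑_{|m| = N} c^m`. [folklore] -/
theorem coeff_prod_geom (c : Fin n → R) (N : ℕ) :
    coeff N (∏ i, geom (c i)) = ∑ m ∈ piAntidiag univ N, ∏ i, c i ^ m i := by
  classical
  rw [PowerSeries.coeff_prod]
  simp only [coeff_geom]
  exact sum_finsuppAntidiag_eq_sum_piAntidiag N (fun m => ∏ i, c i ^ m i)

/-- The monomial expansion `h_k(x) = ∑_{|m| = k} x^m` of the complete homogeneous symmetric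
polynomial (Macdonald 1995, Ch. I §2, definition of `h_r`). [folklore] -/
theorem hsymm_eq_sum_piAntidiag (x : Fin n → R) (k : ℕ) :
    hsymm x k = ∑ m ∈ piAntidiag univ k, ∏ i, x i ^ m i :=
  coeff_prod_geom x k

/-- `A_{x,y}(T) = ∑_σ sign(σ) ∏_i (1 - x_{σ(i)} y_i T)⁻¹`. [folklore] -/
theorem altSeries_eq_sum (x y : Fin n → R) :
    altSeries x y = ∑ σ : Perm (Fin n),
      PowerSeries.C (((Equiv.Perm.sign σ : ℤ) : R)) * ∏ i, geom (x (σ i) * y i) := by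
  ext N
  simp only [altSeries, coeff_mk, map_sum, PowerSeries.coeff_C_mul, coeff_prod_geom]
  simp_rw [alternant_eq_sum, Finset.sum_mul, Finset.mul_sum]
  rw [Finset.sum_comm]
  refine Finset.sum_congr rfl fun σ _ => Finset.sum_congr rfl fun m _ => ?_
  rw [mul_assoc, ← Finset.prod_mul_distrib]
  simp_rw [mul_pow]

/-- `∏_i (1 - x_{σ(i)} y_i T)⁻¹ · ∏_{i,j} (1 - x_i y_j T) = ∏_i ∏_{j ≠ i} (1 - x_{σ(i)} y_j T)`.
[folklore] -/
theorem prod_geom_mul_cauchyProd (x y : Fin n → R) (σ : Perm (Fin n)) :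
    (∏ i, geom (x (σ i) * y i)) * cauchyProd x y =
      ∏ i, ∏ j ∈ univ.erase i, (1 - C (x (σ i) * y j) * X) := by
  unfold cauchyProd
  rw [← Equiv.prod_comp σ (fun i => ∏ j, (1 - C (x i * y j) * X)), ← Finset.prod_mul_distrib]
  refine Finset.prod_congr rfl fun i _ => ?_
  rw [← Finset.mul_prod_erase univ (fun j => 1 - C (x (σ i) * y j) * X) (mem_univ i), ← mul_assoc,
    geom_mul_one_sub, one_mul]

/-- `A_{x,y}(T) · ∏_{i,j}(1 - x_i y_j T) = T^{|ρ|} a_ρ(x) a_ρ(y)`: Cauchy's determinant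
(`det_prod_one_sub_mul`) applied in `R⟦T⟧` to `x` and `yT`. [folklore] -/
theorem altSeries_mul_cauchyProd (x y : Fin n → R) :
    altSeries x y * cauchyProd x y =
      X ^ (∑ i, rho n i) * C (alternant x (rho n) * alternant y (rho n)) := by
  have h := det_prod_one_sub_mul (R := R⟦X⟧) (fun i => C (x i)) (fun j => C (y j) * X)
  rw [Matrix.det_apply'] at h
  have hL : altSeries x y * cauchyProd x y = ∑ σ : Perm (Fin n), ((Equiv.Perm.sign σ : ℤ) : R⟦X⟧) *
      ∏ i, (Matrix.of fun i j : Fin n => ∏ k ∈ univ.erase j,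
        (1 - C (x i) * (C (y k) * X))) (σ i) i := by
    rw [altSeries_eq_sum, Finset.sum_mul]
    refine Finset.sum_congr rfl fun σ _ => ?_
    rw [mul_assoc, prod_geom_mul_cauchyProd, map_intCast]
    congr 1
    simp only [Matrix.of_apply, map_mul, mul_assoc]
  have hR1 : alternant (fun i => (C (x i) : R⟦X⟧)) (rho n) = C (alternant x (rho n)) :=
    (map_alternant (C : R →+* R⟦X⟧) x (rho n)).symm
  have hR2 : alternant (fun j => (C (y j) : R⟦X⟧) * X) (rho n) =
      X ^ (∑ i, rho n i) * C (alternant y (rho n)) := by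
    have : (fun j => (C (y j) : R⟦X⟧) * X) = (X : R⟦X⟧) • (fun j => C (y j)) := by
      funext j
      simp [mul_comm]
    rw [this, alternant_smul, map_alternant]
    rfl
  rw [hL, h, hR1, hR2, map_mul]
  ring

/-! ### Sorting injective weights -/

/-- `λ + ρ` is strictly decreasing for antitone `λ`. [folklore] -/
theorem strictAnti_add_rho {la : Fin n → ℕ} (hla : Antitone la) : StrictAnti (la + rho n) := by
  intro i j hij
  simp only [Pi.add_apply, rho_apply]
  have h1 := hla hij.le
  have h2 := j.is_lt
  have h3 : (i : ℕ) < j := hij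
  omega

/-- Uniqueness of sorting: `(λ + ρ) ∘ τ = (λ' + ρ) ∘ τ'` with `λ, λ'` antitone forces `λ = λ'` and
`τ = τ'`. [folklore] -/
theorem eq_of_add_rho_comp_perm_eq {la la' : Fin n → ℕ} (hla : Antitone la) (hla' : Antitone la')
    {τ τ' : Perm (Fin n)} (h : (la + rho n) ∘ τ = (la' + rho n) ∘ τ') : la = la' ∧ τ = τ' := by
  have hs := strictAnti_add_rho hla
  have hs' := strictAnti_add_rho hla'
  have hrange : Set.range (la + rho n) = Set.range (la' + rho n) := by
    rw [← τ.surjective.range_comp (la + rho n), h, τ'.surjective.range_comp]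
  have heq : la + rho n = la' + rho n := (hs.range_inj hs').mp hrange
  refine ⟨add_right_cancel heq, Equiv.ext fun i => hs.injective ?_⟩
  have := congrFun h i
  rwa [← heq] at this

/-- Sorting: an injective `m ∈ ℕⁿ` is `(λ + ρ) ∘ τ` for an antitone `λ` and a permutation `τ`
(Macdonald 1995, Ch. I §3: "we may write `α = λ + δ`"). [folklore] -/
theorem exists_antitone_add_rho_comp_perm {m : Fin n → ℕ} (hm : Function.Injective m) :
    ∃ la : Fin n → ℕ, Antitone la ∧ ∃ τ : Perm (Fin n), m = (la + rho n) ∘ τ := by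
  set σ := Tuple.sort m with hσ
  have hmono : StrictMono (m ∘ σ) :=
    (Tuple.monotone_sort m).strictMono_of_injective (hm.comp σ.injective)
  set μ : Fin n → ℕ := fun i => m (σ (Fin.rev i)) with hμdef
  have hμ : StrictAnti μ := fun i j hij => hmono (Fin.rev_strictAnti hij)
  -- `μ j + (j - i) ≤ μ i` for `i ≤ j`
  have hstep : ∀ d : ℕ, ∀ i j : Fin n, (j : ℕ) = i + d → μ j + d ≤ μ i := by
    intro d
    induction d with
    | zero =>
      intro i j hij
      rw [Fin.ext hij]
      simp
    | succ d ih =>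
      intro i j hij
      have hj := j.is_lt
      set j' : Fin n := ⟨(i : ℕ) + d, by omega⟩ with hj'
      have h1 := ih i j' rfl
      have h2 : μ j < μ j' := hμ (show j' < j from by rw [Fin.lt_def, hj']; simp; omega)
      omega
  have hlow : ∀ i : Fin n, rho n i ≤ μ i := fun i => by
    have hi := i.is_lt
    have := hstep (n - 1 - i) i ⟨n - 1, by omega⟩ (by simp; omega)
    rw [rho_apply]
    omega
  refine ⟨fun i => μ i - rho n i, ?_, σ.symm.trans Fin.revPerm, ?_⟩
  · intro i j hij
    have := hstep ((j : ℕ) - i) i j (by have : (i : ℕ) ≤ j := hij; omega)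
    simp only [rho_apply]
    have hi := i.is_lt
    have hj := j.is_lt
    have : (i : ℕ) ≤ j := hij
    omega
  · funext i
    simp only [Function.comp_apply, Pi.add_apply, Equiv.trans_apply, Fin.revPerm_apply]
    rw [Nat.sub_add_cancel (hlow _), hμdef]
    simp

/-- An injective `m ∈ ℕⁿ` has `|m| ≥ |ρ| = n(n-1)/2`. [folklore] -/
theorem sum_eq_of_injective {m : Fin n → ℕ} (hm : Function.Injective m) :
    ∃ N, ∑ i, m i = N + ∑ i, rho n i := by
  obtain ⟨la, _, τ, rfl⟩ := exists_antitone_add_rho_comp_perm hm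
  refine ⟨∑ i, la i, ?_⟩
  rw [← Finset.sum_add_distrib, ← Equiv.sum_comp τ (fun i => la i + rho n i)]
  rfl

/-- The finset of antitone weights `λ ∈ ℕⁿ` (`λ_1 ≥ … ≥ λ_n ≥ 0`, partitions of length `≤ n`) with
`|λ| = N`. [folklore] -/
def antitoneWeights (n N : ℕ) : Finset (Fin n → ℕ) :=
  (piAntidiag univ N).filter fun la => ∀ i j : Fin n, i ≤ j → la j ≤ la i

/-- Membership in `antitoneWeights`. [folklore] -/
theorem mem_antitoneWeights {N : ℕ} {la : Fin n → ℕ} :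
    la ∈ antitoneWeights n N ↔ ∑ i, la i = N ∧ Antitone la := by
  simp only [antitoneWeights, Finset.mem_filter, mem_piAntidiag, mem_univ, imp_true_iff, and_true]
  rfl

/-- **Regrouping by sorting**: for `F` vanishing at non-injective weights, `∑_{|m| = N + |ρ|} F(m)
= ∑_{λ antitone, |λ| = N} ∑_τ F((λ + ρ) ∘ τ)`. [folklore] -/
theorem sum_piAntidiag_eq_sum_antitoneWeights {A : Type*} [AddCommMonoid A]
    (F : (Fin n → ℕ) → A) (hF : ∀ m, ¬ Function.Injective m → F m = 0) (N : ℕ) :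
    ∑ m ∈ piAntidiag univ (N + ∑ i, rho n i), F m =
      ∑ la ∈ antitoneWeights n N, ∑ τ : Perm (Fin n), F ((la + rho n) ∘ τ) := by
  rw [← Finset.sum_product']
  symm
  refine Finset.sum_bij_ne_zero (fun p _ _ => (p.1 + rho n) ∘ p.2) ?_ ?_ ?_ ?_
  · rintro ⟨la, τ⟩ hp -
    rw [Finset.mem_product] at hp
    obtain ⟨hla, -⟩ := hp
    rw [mem_antitoneWeights] at hla
    rw [mem_piAntidiag]
    refine ⟨?_, fun i _ => mem_univ i⟩
    change ∑ i, (la + rho n) (τ i) = _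
    rw [Equiv.sum_comp τ (la + rho n), ← hla.1, ← Finset.sum_add_distrib]
    rfl
  · rintro ⟨la, τ⟩ hp - ⟨la', τ'⟩ hp' - h
    rw [Finset.mem_product, mem_antitoneWeights] at hp hp'
    obtain ⟨h1, h2⟩ := eq_of_add_rho_comp_perm_eq hp.1.2 hp'.1.2 h
    exact Prod.ext h1 h2
  · intro m hm hFm
    have hinj : Function.Injective m := by
      by_contra h
      exact hFm (hF m h)
    obtain ⟨la, hla, τ, rfl⟩ := exists_antitone_add_rho_comp_perm hinj
    refine ⟨(la, τ), ?_, hFm, rfl⟩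
    rw [Finset.mem_product, mem_antitoneWeights]
    dsimp only
    refine ⟨⟨?_, hla⟩, mem_univ _⟩
    rw [mem_piAntidiag] at hm
    have h1 := hm.1
    change ∑ i, (la + rho n) (τ i) = _ at h1
    rw [Equiv.sum_comp τ (la + rho n)] at h1
    change ∑ i, (la i + rho n i) = _ at h1
    rw [Finset.sum_add_distrib] at h1
    omega
  · intro p _ _
    rfl

/-- For `F` vanishing at non-injective weights, `∑_{|m| = N} F(m) = 0` when `N < |ρ|`. [folklore] -/
theorem sum_piAntidiag_eq_zero_of_lt {A : Type*} [AddCommMonoid A]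
    (F : (Fin n → ℕ) → A) (hF : ∀ m, ¬ Function.Injective m → F m = 0) {N : ℕ}
    (hN : N < ∑ i, rho n i) : ∑ m ∈ piAntidiag univ N, F m = 0 := by
  refine Finset.sum_eq_zero fun m hm => hF m fun hinj => ?_
  obtain ⟨N', hN'⟩ := sum_eq_of_injective hinj
  rw [mem_piAntidiag] at hm
  have := hm.1
  change ∑ i, m i = N at this
  omega

/-- `∑_τ sign(τ) y^{μ ∘ τ} = a_μ(y)`. [folklore] -/
theorem sum_sign_mul_prod_pow_comp (y : Fin n → R) (μ : Fin n → ℕ) :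
    ∑ τ : Perm (Fin n), ((Equiv.Perm.sign τ : ℤ) : R) * ∏ i, y i ^ μ (τ i) = alternant y μ := by
  rw [alternant_eq_sum, ← Equiv.sum_comp (Equiv.inv (Perm (Fin n)))]
  refine Finset.sum_congr rfl fun σ _ => ?_
  simp only [Equiv.inv_apply, Equiv.Perm.sign_inv]
  congr 1
  rw [← Equiv.prod_comp σ (fun i => y i ^ μ (σ⁻¹ i))]
  simp

/-! ### Cauchy's identity for Schur polynomials -/

/-- The Cauchy kernel series `Z_{x,y}(T) = ∑_{λ} s_λ(x) s_λ(y) T^{|λ|}`, summed over antitone `λ ∈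
ℕⁿ`. [folklore] -/
def cauchySeries (x y : Fin n → R) : R⟦X⟧ :=
  PowerSeries.mk fun N => ∑ la ∈ antitoneWeights n N, schur x la * schur y la

/-- `A_{x,y}(T) = T^{|ρ|} a_ρ(x) a_ρ(y) Z_{x,y}(T)`: regroup `∑_m a_m(x) y^m` by sorting `m = (λ +
ρ) ∘ τ`, use `∑_τ sign(τ) y^{(λ+ρ)∘τ} = a_{λ+ρ}(y)` and the bialternant formula. [folklore] -/
theorem altSeries_eq_X_pow_mul (x y : Fin n → R) :
    altSeries x y =
      X ^ (∑ i, rho n i) * (C (alternant x (rho n) * alternant y (rho n)) * cauchySeries x y) := by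
  have hF : ∀ m : Fin n → ℕ, ¬ Function.Injective m → alternant x m * ∏ i, y i ^ m i = 0 := by
    intro m hm
    simp only [Function.Injective, not_forall, exists_prop] at hm
    obtain ⟨i, j, hij, hne⟩ := hm
    rw [alternant_eq_zero_of_apply_eq x hne hij, zero_mul]
  ext N
  rw [PowerSeries.coeff_X_pow_mul']
  split_ifs with h
  · obtain ⟨N, rfl⟩ : ∃ N', N = N' + ∑ i, rho n i := ⟨N - ∑ i, rho n i, by omega⟩
    rw [Nat.add_sub_cancel, PowerSeries.coeff_C_mul, cauchySeries, coeff_mk, altSeries, coeff_mk,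
      sum_piAntidiag_eq_sum_antitoneWeights _ hF, Finset.mul_sum]
    refine Finset.sum_congr rfl fun la _ => ?_
    have : ∀ τ : Perm (Fin n),
        alternant x ((la + rho n) ∘ τ) * ∏ i, y i ^ ((la + rho n) ∘ τ) i =
          alternant x (la + rho n) *
            (((Equiv.Perm.sign τ : ℤ) : R) * ∏ i, y i ^ (la + rho n) (τ i)) :=
      fun τ => by rw [alternant_comp_perm]; simp only [Function.comp_apply]; ring
    simp_rw [this]
    rw [← Finset.mul_sum, sum_sign_mul_prod_pow_comp, alternant_add_rho, alternant_add_rho]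
    ring
  · rw [altSeries, coeff_mk, sum_piAntidiag_eq_zero_of_lt _ hF (not_le.mp h)]

/-- `Z_{x,y}` commutes with ring homomorphisms. [folklore] -/
theorem map_cauchySeries {S : Type*} [CommRing S] (f : R →+* S) (x y : Fin n → R) :
    PowerSeries.map f (cauchySeries x y) = cauchySeries (f ∘ x) (f ∘ y) := by
  ext N
  simp [cauchySeries, map_sum, map_schur]

/-- `Π_{x,y}` commutes with ring homomorphisms. [folklore] -/
theorem map_cauchyProd {S : Type*} [CommRing S] (f : R →+* S) (x y : Fin n → R) :
    PowerSeries.map f (cauchyProd x y) = cauchyProd (f ∘ x) (f ∘ y) := by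
  simp [cauchyProd, map_prod]

/-- **Cauchy's identity** `∑_λ s_λ(x) s_λ(y) T^{|λ|} · ∏_{i,j} (1 - x_i y_j T) = 1` in `R⟦T⟧`, for
`x, y ∈ Rⁿ` in any commutative ring, the sum over antitone `λ ∈ ℕⁿ` (Macdonald 1995, Ch. I
(4.3): `∏_{i,j}(1 - x_i y_j)⁻¹ = ∑_λ s_λ(x) s_λ(y)`; in `n` variables only `l(λ) ≤ n`
contribute). Proved at the generic point `ℤ[X, Y]` by cancelling `T^{|ρ|} a_ρ(X) a_ρ(Y) ≠ 0`
in `altSeries_mul_cauchyProd` = `altSeries_eq_X_pow_mul`, then specialised.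
[cite: Macdonald1995, Ch. I (4.3)] -/
theorem cauchySeries_mul_cauchyProd (x y : Fin n → R) : cauchySeries x y * cauchyProd x y = 1 := by
  -- generic point
  have key : ∀ (X₁ Y₁ : Fin n → MvPolynomial (Fin n ⊕ Fin n) ℤ), Function.Injective X₁ →
      Function.Injective Y₁ → cauchySeries X₁ Y₁ * cauchyProd X₁ Y₁ = 1 := by
    intro X₁ Y₁ hX hY
    have h := altSeries_mul_cauchyProd X₁ Y₁
    rw [altSeries_eq_X_pow_mul, mul_assoc, mul_assoc] at h
    have hne : (X : (MvPolynomial (Fin n ⊕ Fin n) ℤ)⟦X⟧) ^ (∑ i, rho n i) *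
        C (alternant X₁ (rho n) * alternant Y₁ (rho n)) ≠ 0 := by
      refine mul_ne_zero (pow_ne_zero _ PowerSeries.X_ne_zero) ?_
      intro h0
      have : alternant X₁ (rho n) * alternant Y₁ (rho n) = 0 := by
        have := congrArg (coeff 0) h0
        simpa using this
      exact mul_ne_zero (alternant_rho_ne_zero hX) (alternant_rho_ne_zero hY) this
    have h' := h
    rw [← mul_assoc] at h'
    conv_rhs at h' =>
      rw [← mul_one (X ^ (∑ i, rho n i) * C (alternant X₁ (rho n) * alternant Y₁ (rho n)))]
    exact mul_left_cancel₀ hne h'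
  set f : MvPolynomial (Fin n ⊕ Fin n) ℤ →+* R :=
    MvPolynomial.eval₂Hom (Int.castRingHom R) (Sum.elim x y) with hf
  have hx : (f ∘ (MvPolynomial.X ∘ Sum.inl) : Fin n → R) = x := funext fun i => by simp [hf]
  have hy : (f ∘ (MvPolynomial.X ∘ Sum.inr) : Fin n → R) = y := funext fun i => by simp [hf]
  have h := congrArg (PowerSeries.map f)
    (key (MvPolynomial.X ∘ Sum.inl) (MvPolynomial.X ∘ Sum.inr)
      (MvPolynomial.X_injective.comp Sum.inl_injective)
      (MvPolynomial.X_injective.comp Sum.inr_injective))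
  rwa [map_mul, map_one, map_cauchySeries, map_cauchyProd, hx, hy] at h

/-- **Cauchy's identity for two solutions of the dual Pieri recursions** (the algebraic content of
the unramified Rankin–Selberg computation `∫ W W' Φ |det|^s = det(1 - q^{-s} A ⊗ A')⁻¹`,
Jacquet–Shalika 1981 §2, via Shintani's formula): if `w, w' : ℕⁿ → R` vanish off the antitone
weights and satisfy `e_r(x) w(λ) = ∑_{#S=r} w(λ + 1_S)`, `e_r(y) w'(λ) = ∑_{#S=r} w'(λ + 1_S)`
(antitone `λ`, `1 ≤ r ≤ n`), then `(∑_N ∑_{|m| = N} w(m) w'(m) T^N) · ∏_{i,j}(1 - x_i y_j T) =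
w(0) w'(0)`, i.e. `∑_m w(m) w'(m) T^{|m|} = w(0) w'(0) ∏_{i,j} (1 - x_i y_j T)⁻¹`. [folklore] -/
theorem mk_sum_mul_mul_cauchyProd (x y : Fin n → R) (w w' : (Fin n → ℕ) → R)
    (h0 : ∀ ν, ¬ Antitone ν → w ν = 0)
    (hrec : ∀ la, Antitone la → ∀ r, 1 ≤ r → r ≤ n →
      esymm x r * w la = ∑ S ∈ powersetCard r univ, w (addOn S la))
    (h0' : ∀ ν, ¬ Antitone ν → w' ν = 0)
    (hrec' : ∀ la, Antitone la → ∀ r, 1 ≤ r → r ≤ n →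
      esymm y r * w' la = ∑ S ∈ powersetCard r univ, w' (addOn S la)) :
    (PowerSeries.mk fun N => ∑ m ∈ piAntidiag univ N, w m * w' m) * cauchyProd x y =
      C (w 0 * w' 0) := by
  have hser : (PowerSeries.mk fun N => ∑ m ∈ piAntidiag univ N, w m * w' m) =
      C (w 0 * w' 0) * cauchySeries x y := by
    ext N
    rw [coeff_mk, PowerSeries.coeff_C_mul, cauchySeries, coeff_mk, Finset.mul_sum,
      ← Finset.sum_filter_of_ne (s := piAntidiag univ N)
        (p := fun la : Fin n → ℕ => ∀ i j : Fin n, i ≤ j → la j ≤ la i) ?_]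
    · refine Finset.sum_congr rfl fun m hm => ?_
      have hm' : Antitone m := (mem_antitoneWeights.mp hm).2
      rw [eq_schur_smul_of_pieri x w h0 hrec hm', eq_schur_smul_of_pieri y w' h0' hrec' hm']
      simp only [smul_eq_mul]
      ring
    · intro m _ hne
      by_contra hanti
      apply hne
      rw [h0 m (fun h => hanti (fun i j hij => h hij)), zero_mul]
  rw [hser, mul_assoc, cauchySeries_mul_cauchyProd, mul_one]

end Literature.RingTheory.SymmetricFunctions.SymmPoly
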